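import Mathlib.Analysis.Complex.ExponentialBounds
import Summits.Ventures.WeilGRH.DualTrigCertMod11Class2Log5Half
import Summits.Ventures.WeilGRH.DualTrigCertMod11Class7Log5Half
import Summits.Ventures.WeilGRH.DualTrigCertMod11OddLog5Half
import HarnessLib

/-!
# Every odd Dirichlet character mod 11: Weil positivity on `[−(log 5)/2, (log 5)/2]`, at the ζ frontier `4023/5000`, and at `log 2`

Cell `rh-explicit`, WEIL TRACK — GRH ARM, route B (weil-grh-3, gen14).  Assembly (no kernel work) of the format-D-K instance files
of the odd key classes of conductor 11 at the standard rung `N = 4`, `t = (log 5)/2`: `DualTrigCertMod11Class2Log5Half` (census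
`11.2`/`11.6`: `χ(2) = e(±1/10)`), `DualTrigCertMod11Class7Log5Half` (`11.7`/`11.8`: `χ(2) = e(∓3/10)`) and gen2's
`DualTrigCertMod11OddLog5Half` (the Legendre symbol `(·/11)`: `χ(2) = −1`, `χ(3) = 1`).  Since `2` generates `(ℤ/11)ˣ`, `χ(2)¹⁰ = 1`;
for an odd character `χ(2)⁵ = χ(−1) = −1`, so `χ(2) = e(k/10)` with `k` odd — exactly the five certified classes.  Headline:
`weilPositivityOnChar_mod11_log5half_of_odd` — for EVERY Dirichlet character `χ` mod 11 with `χ(−1) = −1` and every smooth `g` supported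
in `[−(log 5)/2, (log 5)/2]`, `Re W_χ(g ⋆ g̃) ≥ 0`; corollaries at the ζ frontier `4023/5000` and at `log 2` by `WeilPositivityOnChar.mono`.
Honest scope: theorems for these characters and windows only.  No named facts, no `sorry`; axioms standard.
-/

namespace Summit.Ventures.WeilGRH

open Literature.NumberTheory.LFunctions

/-- `exp (2πi/10)^k = exp (2πi·(k/10))`. [folklore] -/
theorem exp_tenth_pow (k : ℕ) :
    Complex.exp (2 * Real.pi * Complex.I / 10) ^ k = Complex.exp (2 * Real.pi * Complex.I * ((k : ℂ) / 10)) := by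
  rw [← Complex.exp_nat_mul]; congr 1; ring

/-- **Every ODD Dirichlet character mod 11 satisfies Weil positivity on `[−(log 5)/2, (log 5)/2]`.**  `2` generates `(ℤ/11)ˣ`,
`χ(2)¹⁰ = 1` and `χ(2)⁵ = χ(−1) = −1`, so `χ(2) = e(k/10)` with `k` odd: `k = 1, 9` are the census classes `11.2`/`11.6`
(`DualTrigCertMod11Class2Log5Half`), `k = 3, 7` are `11.8`/`11.7` (`DualTrigCertMod11Class7Log5Half`), `k = 5` is the quadratic
character `(·/11)` (`DualTrigCertMod11OddLog5Half`, gen2; `χ(3) = χ(2)⁸ = 1`) — five kernel-certified key classes. [folklore] -/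
theorem weilPositivityOnChar_mod11_log5half_of_odd (χ : DirichletCharacter ℂ 11) (hχ : χ.Odd) :
    WeilPositivityOnChar χ (Real.log 5 / 2) := by
  have h10 : χ (2 : ZMod 11) ^ 10 = 1 := by
    rw [← map_pow, show (2 : ZMod 11) ^ 10 = 1 by decide, map_one]
  have h5 : χ (2 : ZMod 11) ^ 5 = -1 := by
    rw [← map_pow, show (2 : ZMod 11) ^ 5 = -1 by decide]; exact hχ
  have hprim : IsPrimitiveRoot (Complex.exp (2 * Real.pi * Complex.I / 10)) 10 :=
    Complex.isPrimitiveRoot_exp 10 (by norm_num)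
  obtain ⟨k, hk, hζ⟩ := hprim.eq_pow_of_pow_eq_one h10
  rw [exp_tenth_pow] at hζ
  have hodd : ¬ (∃ j : ℕ, k = 2 * j) := by
    rintro ⟨j, rfl⟩
    have h1 : χ (2 : ZMod 11) ^ 5 = 1 := by
      rw [← hζ, ← Complex.exp_nat_mul, Complex.exp_eq_one_iff]
      exact ⟨(j : ℤ), by push_cast; ring⟩
    rw [h1] at h5
    norm_num at h5
  interval_cases k
  · exact absurd ⟨0, rfl⟩ hodd
  · exact weilPositivityOnChar_mod11_class2_log5half χ (by rw [← hζ]; push_cast; ring_nf)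
  · exact absurd ⟨1, rfl⟩ hodd
  · exact weilPositivityOnChar_mod11_class7_log5half_conj χ (by rw [← hζ]; push_cast; ring_nf)
  · exact absurd ⟨2, rfl⟩ hodd
  · -- `χ(2) = e(5/10) = −1`: the Legendre symbol mod 11
    have h2 : χ (2 : ZMod 11) = -1 := by
      rw [← hζ]
      conv_rhs => rw [DKCert.neg_one_eq_expPhase]
      rw [Complex.exp_eq_exp_iff_exists_int]
      exact ⟨0, by push_cast; ring⟩
    have h3 : χ (3 : ZMod 11) = 1 := by
      rw [show (3 : ZMod 11) = 2 ^ 8 by decide, map_pow, h2]; norm_num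
    exact weilPositivityOnChar_mod11_odd_real_log5half χ (charParity_of_odd hχ) h2 h3
  · exact absurd ⟨3, rfl⟩ hodd
  · refine weilPositivityOnChar_mod11_class7_log5half χ ?_
    rw [← hζ, Complex.exp_eq_exp_iff_exists_int]
    exact ⟨1, by push_cast; ring⟩
  · exact absurd ⟨4, rfl⟩ hodd
  · refine weilPositivityOnChar_mod11_class2_log5half_conj χ ?_
    rw [← hζ, Complex.exp_eq_exp_iff_exists_int]
    exact ⟨1, by push_cast; ring⟩

/-- **The ζ frontier `4023/5000` for every odd Dirichlet character mod 11.** [folklore] -/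
theorem weilPositivityOnChar_mod11_frontier_of_odd (χ : DirichletCharacter ℂ 11) (hχ : χ.Odd) :
    WeilPositivityOnChar χ (4023 / 5000) :=
  (weilPositivityOnChar_mod11_log5half_of_odd χ hχ).mono (by have h := Real.log_five_gt_d9; linarith)

/-- **`t = log 2` for every odd Dirichlet character mod 11** (`log 2 ≤ (log 5)/2`). [folklore] -/
theorem weilPositivityOnChar_mod11_log_two_of_odd (χ : DirichletCharacter ℂ 11) (hχ : χ.Odd) :
    WeilPositivityOnChar χ (Real.log 2) := by
  refine (weilPositivityOnChar_mod11_log5half_of_odd χ hχ).mono ?_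
  have h4 : Real.log 4 = 2 * Real.log 2 := by
    rw [show (4 : ℝ) = 2 ^ 2 by norm_num, Real.log_pow]; push_cast; ring
  have h45 : Real.log 4 ≤ Real.log 5 := Real.log_le_log (by norm_num) (by norm_num)
  linarith

end Summit.Ventures.WeilGRH
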